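/-
HONEST FRAMING: certified error envelopes and provably optimal rounding/accumulation schemes for
low-precision formats under stated cost models; every table by two implementations; no hardware or
vendor claims.
-/
import Summits.Ventures.CertifiedArithmetic.LowPrec.OptChainLabelsEffWitness

/-!
# Labelled chains: the witness summands lie in the step's OWN format (OPTIMA.md §B, T9(f))

The attainment theorems `lchain_eff_attained` (T9(f)(i), ties downward) and `lchain_rne_attained`
(T9(f)(ii), ties to even) use the witness chain `witSteps`, whose statements only record that the
summands are nonnegative GRID numbers (`LStep.OK`).  In fact every summand is a float of the format
of its own step: at an addition at precision `π` followed by `T`,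
`x = 2^E (u_π + Rsum π T) = (1 + 2N) · 2^(E-π)` with `N < 2^(π-1)` (`isFloat_witSummand`), and a
conversion adds `0`.  So the worst cases `U_eff/(1+U_eff)` resp. `U/(1+U)` are attained with data
CONFINED TO THE STEPS' OWN FORMATS — exactly the data class of certificate C21's rows (f), whose
2363/2363 adversarial equalities and 1702/1702 RNE equalities are therefore these theorems in range.
-/

namespace Summit.Ventures.CertifiedArithmetic.LowPrec.Opt

open Literature.ComputerArithmetic.JeannerodRump2018

/-- The witness summand of an addition at precision `π ≥ 1` (scale `2^E`, `emin + π ≤ E`) is a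
float of `F(π)`: `2^E (u_π + Rsum π T) = (1 + 2N) 2^(E-π)`, `N < 2^(π-1)`. -/
theorem isFloat_witSummand {emin E : ℤ} {π : ℕ} (hπ : 1 ≤ π) (hπE : emin + π ≤ E)
    (T : List (ℕ × Bool)) (hT : ∀ q ∈ T, 1 ≤ q.1) :
    IsFloat π emin ((2 : ℚ) ^ E * (unitRoundoff π + Rsum π T)) := by
  obtain ⟨k, rfl⟩ : ∃ k, π = k + 1 := ⟨π - 1, by omega⟩
  obtain ⟨N, hN, hR⟩ := Rsum_repr T k hT
  have hNz : (N : ℤ) < 2 ^ k := by exact_mod_cast hN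
  refine ⟨1 + 2 * N, E - (k + 1), ?_, by push_cast at hπE ⊢; omega, ?_⟩
  · rw [abs_of_nonneg (by positivity), pow_succ]
    linarith
  · rw [hR]
    unfold unitRoundoff
    rw [zpow_sub₀ (by norm_num : (2 : ℚ) ≠ 0), show (k : ℤ) + 1 = ((k + 1 : ℕ) : ℤ) by push_cast; ring,
      zpow_natCast, pow_succ]
    push_cast
    field_simp

/-- EVERY WITNESS SUMMAND IS A FLOAT OF ITS STEP'S OWN FORMAT (conversions add `0`). -/
theorem witSteps_ownFormat {emin E : ℤ} (fl : ℕ → ℚ → ℚ) :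
    ∀ (P : List (ℕ × Bool)), (∀ q ∈ P, 1 ≤ q.1 ∧ emin + q.1 ≤ E) →
      ∀ s ∈ witSteps fl E P, IsFloat s.prec emin s.x
  | [], _, s, hs => by simp [witSteps] at hs
  | (π, true) :: T, hP, s, hs => by
      have hT : ∀ q ∈ T, 1 ≤ q.1 ∧ emin + q.1 ≤ E := fun q hq => hP q (by simp [hq])
      simp only [witSteps, List.mem_cons] at hs
      rcases hs with rfl | hs
      · exact isFloat_zero π emin
      · exact witSteps_ownFormat fl T hT s hs
  | (π, false) :: T, hP, s, hs => by
      obtain ⟨hπ, hπE⟩ := hP (π, false) (by simp)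
      have hT : ∀ q ∈ T, 1 ≤ q.1 ∧ emin + q.1 ≤ E := fun q hq => hP q (by simp [hq])
      simp only [witSteps, List.mem_cons] at hs
      rcases hs with rfl | hs
      · exact isFloat_witSummand hπ hπE T (fun q hq => (hT q hq).1)
      · exact witSteps_ownFormat fl T hT s hs

/-- T9(f)(i) WITH OWN-FORMAT DATA: for every start precision, every add/convert pattern and every
scale clear of underflow, ties-downward nearest roundings and data with EVERY SUMMAND IN ITS STEP'S
OWN FORMAT give `S_n = 2^E` and `acc + Σ x_i = (1 + U_eff) · S_n`. -/
theorem lchain_eff_attained_ownFormat {emin E : ℤ} {fl : ℕ → ℚ → ℚ}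
    (hfl : ∀ π, IsRoundNearest π emin (fl π) ∧ TiesDown π emin (fl π))
    {e₀ : ℕ} (he₀ : 1 ≤ e₀) (he₀E : emin + e₀ ≤ E)
    (P : List (ℕ × Bool)) (hP : ∀ q ∈ P, 1 ≤ q.1 ∧ emin + q.1 ≤ E) :
    (∀ s ∈ witSteps fl E P, IsFloat s.prec emin s.x) ∧
    IsFloat e₀ emin ((2 : ℚ) ^ E * (1 + Rsum e₀ P)) ∧
    (∀ s ∈ witSteps fl E P, s.OK emin) ∧
    lchainEval ((2 : ℚ) ^ E * (1 + Rsum e₀ P)) (witSteps fl E P) = (2 : ℚ) ^ E ∧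
    (2 : ℚ) ^ E * (1 + Rsum e₀ P) + xsum (witSteps fl E P)
      = (1 + ueff e₀ (witSteps fl E P)) * lchainEval ((2 : ℚ) ^ E * (1 + Rsum e₀ P))
          (witSteps fl E P) :=
  ⟨witSteps_ownFormat fl P hP, lchain_eff_attained hfl he₀ he₀E P hP⟩

end Summit.Ventures.CertifiedArithmetic.LowPrec.Opt
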